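import Literature.Probability.Percolation.PlateCrossingEvents
import Literature.Probability.Percolation.FullPlaneCNL
import Literature.Probability.Percolation.AnnulusCrossingBound
import Literature.Probability.Percolation.TriAnnulusCrossing
import Literature.Probability.Percolation.LoopRepresentation
import Literature.Probability.RandomPlanarGeometry.LoopConfigurations

/-!
# The two loop-transfer stubs T1/T2 of stub C, cut into extraction + blocking

Lead's interface file (crux stmt-CriticalPhenomena-4837, line oracle-sandwich).

* `TriLoopArc` (T1a, 𝕋 + plane topology only): an open AND a closed vertical crossing of the plate
  `V(x, yin, yout)` force a honeycomb interface loop with a based representative `β` and a parameter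
  interval `[s, t]` whose image lies in `Φ(plateBox (x + c/2) yin)` and joins the zones
  `im ≤ -(yin - c/2)` / `yin - c/2 ≤ im`.
* `ZdBlockedByCloseArc` (T1b, coupling + ℤ²): such an arc, `η`-close (unoriented loop distance) to
  the ℤ² loops, kills every monochromatic horizontal crossing of `H(x + c, xout, yin - c)`.
* `ZdLoopArc` (T2a, ℤ² + plane topology only): a primal AND a dual horizontal crossing of
  `H(xin, xout, y)` force a medial interface loop with a based representative `α` and a parameter
  interval whose image lies in `Φ(plateBox xin (y + c/2))` and joins `re ≤ -(xin - c/2)` to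
  `xin - c/2 ≤ re`.
* `TriBlockedByCloseArc` (T2b, coupling + 𝕋): such an arc kills every monochromatic vertical
  crossing of `V(xin - c, y + c, yout')` on `𝕋`.
* `transferVerticalTtoZ_of`, `transferHorizontalZtoT_of`: T1a ∧ T1b ⇒ T1, T2a ∧ T2b ⇒ T2.
-/

noncomputable section

namespace Summit.CriticalPhenomena.CardyFormulaZ2.Cruxes.LoopsToCrossings.OracleSandwich

open Literature.Probability.RandomPlanarGeometry
open Literature.Probability.Percolation
open Literature.Probability.LatticeModels
open Filter Topology Set MeasureTheory Metric Complex unitInterval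

/-- Window hypothesis on `ℤ²`. [folklore] -/
def ZdWindowGood' (δ W₀ W₁ : ℝ) (ω : BondConfig (Site 2)) : Prop :=
  ω ∉ annulusOpenCrossing 0 δ W₀ W₁ ∧ ω ∉ annulusDualCrossing 0 δ W₀ W₁

/-- Window hypothesis on `𝕋`. [folklore] -/
def TriWindowGood' (δ W₀ W₁ : ℝ) (ω : SiteConfig (Site 2)) : Prop :=
  ω ∉ triAnnulusCrossing true δ 0 W₀ W₁ ∧ ω ∉ triAnnulusCrossing false δ 0 W₀ W₁

/-- T1 in tree vocabulary. [folklore] -/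
def TransferVerticalTtoZ' : Prop :=
  ∀ (Φ : ℂ ≃ₜ ℂ) (c : ℝ), 0 < c → ∃ η₀ : ℝ, 0 < η₀ ∧ ∀ η : ℝ, 0 < η → η ≤ η₀ →
    ∃ δ₀ : ℝ, 0 < δ₀ ∧ ∀ δ : ℝ, 0 < δ → δ ≤ δ₀ →
      ∀ (W₀ W₁ : ℝ), Φ '' plateBox 2 2 ⊆ ball (0 : ℂ) W₀ → W₀ < W₁ → W₁ + 1 ≤ 1 / η →
      ∀ (x yin yout : ℝ), c ≤ x → x + c ≤ 2 → 2 * c ≤ yin → yin ≤ yout → yout ≤ 2 →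
      ∀ (ω : BondConfig (Site 2)) (ω' : SiteConfig (Site 2)), ω ⊆ (zdGraph 2).edgeSet →
        LoopConfig.IsClose η (bondLoopConfig δ 0 ω) (siteLoopConfig δ ω') →
        ZdWindowGood' δ W₀ W₁ ω → TriWindowGood' δ W₀ W₁ ω' →
        ω' ∈ triPlateV Φ δ x yin yout → ω'ᶜ ∈ triPlateV Φ δ x yin yout →
        ∀ xout : ℝ, xout ≤ 2 → ω ∉ zdMonoPlateH Φ δ (x + c) xout (yin - c)

/-- T2 in tree vocabulary. [folklore] -/
def TransferHorizontalZtoT' : Prop :=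
  ∀ (Φ : ℂ ≃ₜ ℂ) (c : ℝ), 0 < c → ∃ η₀ : ℝ, 0 < η₀ ∧ ∀ η : ℝ, 0 < η → η ≤ η₀ →
    ∃ δ₀ : ℝ, 0 < δ₀ ∧ ∀ δ : ℝ, 0 < δ → δ ≤ δ₀ →
      ∀ (W₀ W₁ : ℝ), Φ '' plateBox 2 2 ⊆ ball (0 : ℂ) W₀ → W₀ < W₁ → W₁ + 1 ≤ 1 / η →
      ∀ (xin xout y : ℝ), 2 * c ≤ xin → xin ≤ xout → xout ≤ 2 → c ≤ y → y + c ≤ 2 →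
      ∀ (ω : BondConfig (Site 2)) (ω' : SiteConfig (Site 2)), ω ⊆ (zdGraph 2).edgeSet →
        LoopConfig.IsClose η (bondLoopConfig δ 0 ω) (siteLoopConfig δ ω') →
        ZdWindowGood' δ W₀ W₁ ω → TriWindowGood' δ W₀ W₁ ω' →
        ω ∈ zdPlateH (meshPoint δ) Φ xin xout y → dualConfig ω ∈ zdPlateH (dualDraw δ) Φ xin xout y →
        ∀ yout' : ℝ, yout' ≤ 2 → ω' ∉ triMonoPlateV Φ δ (xin - c) (y + c) yout'

/-! ## T1a / T1b -/

/-- **T1a — a honeycomb loop arc between an open and a closed vertical plate crossing.**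
Pure `𝕋` + plane topology: the interface loop separating the two chains (winding bookkeeping with
`loopWind`, summed over the open→closed edges of a lattice path from one chain to the other, every
such edge lying on exactly one interface loop), the component of its trace in the chart rectangle
`[-(x+c/4), x+c/4] × [-(yin-c/4), yin-c/4]` joining bottom to top (transposed continuum duality
`exists_path_avoiding_of_not_crossed'` + crossing lemma + local constancy of `loopWind` off the
trace), turned into a cyclic interval of polygon pieces (non-adjacent pieces of a simple hexagonal
polygon are disjoint), re-based so that it is a parameter interval of a based representative;
window: the loop hugs the open cluster of the open chain, which stays in `B(0, W₁)` by the no-arm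
hypothesis. [folklore] -/
def TriLoopArc : Prop :=
  ∀ (Φ : ℂ ≃ₜ ℂ) (c : ℝ), 0 < c → ∃ δ₀ : ℝ, 0 < δ₀ ∧ ∀ δ : ℝ, 0 < δ → δ ≤ δ₀ →
    ∀ (W₀ W₁ : ℝ), Φ '' plateBox 2 2 ⊆ ball (0 : ℂ) W₀ → W₀ < W₁ →
    ∀ (x yin yout : ℝ), c ≤ x → x + c ≤ 2 → 2 * c ≤ yin → yin ≤ yout → yout ≤ 2 →
    ∀ ω' : SiteConfig (Site 2), TriWindowGood' δ W₀ W₁ ω' →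
      ω' ∈ triPlateV Φ δ x yin yout → ω'ᶜ ∈ triPlateV Φ δ x yin yout →
      ∃ (f : HexVertex) (w : hexGraph.Walk f f), IsSiteInterfaceLoop ω' w ∧
        (siteLoopCurve δ w).range ⊆ ball (0 : ℂ) (W₁ + 1) ∧
        ∃ (β : Curve ℂ) (s t : I), CurveClass.mk β = siteLoopCurve δ w ∧ s ≤ t ∧
          (∀ u ∈ Icc s t, β u ∈ Φ '' plateBox (x + c / 2) yin) ∧
          (∃ u ∈ Icc s t, β u ∈ Φ '' {z : ℂ | z.im ≤ -(yin - c / 2)}) ∧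
          (∃ u ∈ Icc s t, β u ∈ Φ '' {z : ℂ | yin - c / 2 ≤ z.im})

/-- **T1b — a vertical honeycomb loop arc, `η`-close to the `ℤ²` loops, blocks the monochromatic
horizontal `ℤ²` plate crossings.**  `IsClose` gives a medial partner loop at unoriented distance
`≤ η` (the arc's loop has its range in `B(0, 1/η)`); `Curve.exists_orientation_shift_reparam_forall_dist_lt`
moves the parameter interval to a stretch of darts of the partner, pointwise `2η`-close; the left
vertices of the stretch form an open lattice walk and its right faces a dual-open walk
(`nextCorner` bookkeeping), both within `δ` of the stretch, hence (chart room) vertical primal AND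
dual plate crossings of `V(x + c/2 + ν, yin - c/2 - ν, ·)`; plus-position blocking (drawn primal
and dual paths are disjoint + crossing lemma) kills the primal resp. dual horizontal crossings of
`H(x + c, xout, yin - c)`. [folklore] -/
def ZdBlockedByCloseArc : Prop :=
  ∀ (Φ : ℂ ≃ₜ ℂ) (c : ℝ), 0 < c → ∃ η₀ : ℝ, 0 < η₀ ∧ ∀ η : ℝ, 0 < η → η ≤ η₀ →
    ∃ δ₀ : ℝ, 0 < δ₀ ∧ ∀ δ : ℝ, 0 < δ → δ ≤ δ₀ →
    ∀ (x yin : ℝ), c ≤ x → x + c ≤ 2 → 2 * c ≤ yin → yin ≤ 2 →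
    ∀ (ω : BondConfig (Site 2)) (ω' : SiteConfig (Site 2)), ω ⊆ (zdGraph 2).edgeSet →
      LoopConfig.IsClose η (bondLoopConfig δ 0 ω) (siteLoopConfig δ ω') →
      ∀ (f : HexVertex) (w : hexGraph.Walk f f), IsSiteInterfaceLoop ω' w →
        (siteLoopCurve δ w).range ⊆ ball (0 : ℂ) (1 / η) →
        ∀ (β : Curve ℂ) (s t : I), CurveClass.mk β = siteLoopCurve δ w → s ≤ t →
          (∀ u ∈ Icc s t, β u ∈ Φ '' plateBox (x + c / 2) yin) →
          (∃ u ∈ Icc s t, β u ∈ Φ '' {z : ℂ | z.im ≤ -(yin - c / 2)}) →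
          (∃ u ∈ Icc s t, β u ∈ Φ '' {z : ℂ | yin - c / 2 ≤ z.im}) →
          ∀ xout : ℝ, xout ≤ 2 → ω ∉ zdMonoPlateH Φ δ (x + c) xout (yin - c)

/-! ## T2a / T2b -/

/-- **T2a — a medial loop arc between a primal and a dual horizontal plate crossing.**
Pure `ℤ²` + plane topology: (separation) some interface loop `γ` has different winding numbers
around the vertices of the primal chain and the faces of the dual chain (jump relation
`IsInterfaceLoop.wind_sub_wind_cFace` summed along a vertex–face incidence chain, every corner lying
on exactly one loop = its `nextCorner` orbit; constancy along the chains by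
`wind_eq_of_adj_of_mem` / `wind_faceCenter_eq_of_not_mem`); (rounding) the rectilinear polygon
through the coded corners `RectLoop.code` (Smirnov's quarter-offset rounding, `MedialCycleHopf`) is
pointwise `√2/4·δ`-close to the medial polyline, has the same winding numbers at lattice vertices
and face centres, misses open edges and dual-open dual edges, and its non-adjacent unit segments are
disjoint; (extraction) the component of its trace in the chart rectangle
`[-(xin-c/4), xin-c/4] × [-(y+c/4), y+c/4]` joining the two vertical sides (continuum duality
`exists_path_avoiding_of_not_crossed` + crossing lemma + local constancy of `wind`) is covered by a
cyclic interval of segments, whose darts give the parameter interval after re-basing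
(`IsInterfaceLoop.rotate`); window by the no-arm hypotheses. [folklore] -/
def ZdLoopArc : Prop :=
  ∀ (Φ : ℂ ≃ₜ ℂ) (c : ℝ), 0 < c → ∃ δ₀ : ℝ, 0 < δ₀ ∧ ∀ δ : ℝ, 0 < δ → δ ≤ δ₀ →
    ∀ (W₀ W₁ : ℝ), Φ '' plateBox 2 2 ⊆ ball (0 : ℂ) W₀ → W₀ < W₁ →
    ∀ (xin xout y : ℝ), 2 * c ≤ xin → xin ≤ xout → xout ≤ 2 → c ≤ y → y + c ≤ 2 →
    ∀ ω : BondConfig (Site 2), ω ⊆ (zdGraph 2).edgeSet → ZdWindowGood' δ W₀ W₁ ω →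
      ω ∈ zdPlateH (meshPoint δ) Φ xin xout y → dualConfig ω ∈ zdPlateH (dualDraw δ) Φ xin xout y →
      ∃ γ : List MedialVertex, IsInterfaceLoop ω γ ∧
        (loopCurve δ 0 γ).range ⊆ ball (0 : ℂ) (W₁ + 1) ∧
        ∃ (α : Curve ℂ) (s t : I), CurveClass.mk α = loopCurve δ 0 γ ∧ s ≤ t ∧
          (∀ u ∈ Icc s t, α u ∈ Φ '' plateBox xin (y + c / 2)) ∧
          (∃ u ∈ Icc s t, α u ∈ Φ '' {z : ℂ | z.re ≤ -(xin - c / 2)}) ∧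
          (∃ u ∈ Icc s t, α u ∈ Φ '' {z : ℂ | xin - c / 2 ≤ z.re})

/-- **T2b — a horizontal medial loop arc, `η`-close to the honeycomb loops, blocks the
monochromatic vertical `𝕋` plate crossings.**  `IsClose` gives a honeycomb partner at unoriented
distance `≤ η`; `Curve.exists_orientation_shift_reparam_forall_dist_lt` moves the parameter interval
to a connected stretch of the partner's polygon `polyTrace`, pointwise `2η`-close, hence (chart room)
inside the band `|im| < y + c` and reaching `re < -(xin - c)` and `re > xin - c`; a monochromatic
vertical crossing of `V(xin - c, y + c, ·)` would meet it (crossing lemma in the chart: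
`exists_subcontinuum_between_lines`, `exists_subpath_crossing_levels`,
`exists_mem_of_isPreconnected_crossing`), but centre-to-centre segments of equal-colour neighbours
miss every interface polygon (`IsSiteInterfaceLoop.segment_disjoint_polyTrace_of_mem`). [folklore] -/
def TriBlockedByCloseArc : Prop :=
  ∀ (Φ : ℂ ≃ₜ ℂ) (c : ℝ), 0 < c → ∃ η₀ : ℝ, 0 < η₀ ∧ ∀ η : ℝ, 0 < η → η ≤ η₀ →
    ∃ δ₀ : ℝ, 0 < δ₀ ∧ ∀ δ : ℝ, 0 < δ → δ ≤ δ₀ →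
    ∀ (xin y : ℝ), 2 * c ≤ xin → xin ≤ 2 → c ≤ y → y + c ≤ 2 →
    ∀ (ω : BondConfig (Site 2)) (ω' : SiteConfig (Site 2)),
      LoopConfig.IsClose η (bondLoopConfig δ 0 ω) (siteLoopConfig δ ω') →
      ∀ γ : List MedialVertex, IsInterfaceLoop ω γ → (loopCurve δ 0 γ).range ⊆ ball (0 : ℂ) (1 / η) →
        ∀ (α : Curve ℂ) (s t : I), CurveClass.mk α = loopCurve δ 0 γ → s ≤ t →
          (∀ u ∈ Icc s t, α u ∈ Φ '' plateBox xin (y + c / 2)) →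
          (∃ u ∈ Icc s t, α u ∈ Φ '' {z : ℂ | z.re ≤ -(xin - c / 2)}) →
          (∃ u ∈ Icc s t, α u ∈ Φ '' {z : ℂ | xin - c / 2 ≤ z.re}) →
          ∀ yout' : ℝ, yout' ≤ 2 → ω' ∉ triMonoPlateV Φ δ (xin - c) (y + c) yout'

/-! ## Compositions -/

/-- **T1 from T1a and T1b.** [folklore] -/
theorem transferVerticalTtoZ_of (hA : TriLoopArc) (hB : ZdBlockedByCloseArc) : TransferVerticalTtoZ' := by
  intro Φ c hc
  obtain ⟨η₁, hη₁, hB1⟩ := hB Φ c hc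
  refine ⟨η₁, hη₁, fun η hη hηle ↦ ?_⟩
  obtain ⟨δa, hδa, hA'⟩ := hA Φ c hc
  obtain ⟨δ₁, hδ₁, hB1'⟩ := hB1 η hη hηle
  refine ⟨min δa δ₁, lt_min hδa hδ₁, fun δ hδ hδle ↦ ?_⟩
  intro W₀ W₁ hW hW₀₁ hηW x yin yout hx hx2 hyin hyio hyout ω ω' hE hC hwz hwt hVo hVc xout hxout
  obtain ⟨f, w, hw, hrange, β, s, t, hβ, hst, hband, hbot, htop⟩ :=
    hA' δ hδ (hδle.trans (min_le_left _ _)) W₀ W₁ hW hW₀₁ x yin yout hx hx2 hyin hyio hyout ω' hwt hVo hVc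
  have hrange' : (siteLoopCurve δ w).range ⊆ ball (0 : ℂ) (1 / η) :=
    hrange.trans (ball_subset_ball hηW)
  exact hB1' δ hδ (hδle.trans (min_le_right _ _)) x yin hx hx2 hyin (hyio.trans hyout) ω ω' hE hC f w hw
    hrange' β s t hβ hst hband hbot htop xout hxout

/-- **T2 from T2a and T2b.** [folklore] -/
theorem transferHorizontalZtoT_of (hA : ZdLoopArc) (hB : TriBlockedByCloseArc) : TransferHorizontalZtoT' := by
  intro Φ c hc
  obtain ⟨η₁, hη₁, hB1⟩ := hB Φ c hc
  refine ⟨η₁, hη₁, fun η hη hηle ↦ ?_⟩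
  obtain ⟨δa, hδa, hA'⟩ := hA Φ c hc
  obtain ⟨δ₁, hδ₁, hB1'⟩ := hB1 η hη hηle
  refine ⟨min δa δ₁, lt_min hδa hδ₁, fun δ hδ hδle ↦ ?_⟩
  intro W₀ W₁ hW hW₀₁ hηW xin xout y hxin hxio hxout hy hy2 ω ω' hE hC hwz hwt hHp hHd yout' hyout'
  obtain ⟨γ, hγ, hrange, α, s, t, hα, hst, hband, hleft, hright⟩ :=
    hA' δ hδ (hδle.trans (min_le_left _ _)) W₀ W₁ hW hW₀₁ xin xout y hxin hxio hxout hy hy2 ω hE hwz hHp hHd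
  have hrange' : (loopCurve δ 0 γ).range ⊆ ball (0 : ℂ) (1 / η) :=
    hrange.trans (ball_subset_ball hηW)
  exact hB1' δ hδ (hδle.trans (min_le_right _ _)) xin y hxin (hxio.trans hxout) hy hy2 ω ω' hC γ hγ
    hrange' α s t hα hst hband hleft hright yout' hyout'

end Summit.CriticalPhenomena.CardyFormulaZ2.Cruxes.LoopsToCrossings.OracleSandwich

end
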